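import Mathlib
import Summits.MatrixMultiplication.MatrixMultiplication.Theorems.HiddenToeplitzCornersHiddenCornerLemmaRCapacityDict

/-!
# Toolkit G4/G5 — transfer of Krylov dimensions and of frame independence from coefficient
# vectors to polynomials

Support file for crux item `stmt-MatrixMultiplication-10752`
(`Summit.MatrixMultiplication.MatrixMultiplication.Theses.HiddenToeplitzCorners.HiddenCornerLemmaR`),
line `frobenius-dual-short-syzygies`, stubs G4 and G5 of the strip theorem /
`stub_gconstDualLaw`: the matrix data of a hidden corner are translated into the polynomial
frame theory (toolkits A–D) through the dictionary of toolkit E (module `…CapacityDict`).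

Setting.  `toPoly : (Fin N → ℂ) →ₗ[ℂ] ℂ[X]` is `v ↦ Σ_{i<N} v i • X^i`, written
`(Polynomial.degreeLT ℂ N).subtype ∘ₗ (Polynomial.degreeLTEquiv ℂ N).symm.toLinearMap`; `Z` is the
lower shift on `Fin N → ℂ` written verbatim as in the crux (`Z i j = [i = j + 1]`), so `Zᵀ` is the
up-shift; the polynomial frame of `E : Matrix (Fin N) (Fin r) ℂ` is `polyE c' := toPoly (column c'
of E)`.  All statements are in the expanded, notation-free (registered) form.

Results (folklore linear algebra):
* `hclR_finrank_vecKrylov` (G4): the span of the shifted columns `(Zᵀ)^m *ᵥ (column c' of E)`,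
  `m < w`, has the same dimension as the polynomial Krylov space
  `span {divX^[m] (polyE c') : c', m < w}` — the latter is the image of the former under the
  injective linear map `toPoly` (pointwise by (E5) `hclR_toPoly_shiftT_pow_mulVec`), and an
  injective linear map preserves the dimension of a submodule (`Submodule.equivMapOfInjective`);
* `hclR_polyE_linearIndependent` (G5): if `rank E = r` the columns of `E` are linearly independent
  (`Matrix.rank_eq_finrank_span_cols`, `linearIndependent_iff_card_eq_finrank_span`), hence so is
  their image `polyE` under the injective linear map `toPoly` (`LinearIndependent.map'`).
-/

-- the problem namespace `…MatrixMultiplication.MatrixMultiplication…` repeats a component by design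
set_option linter.dupNamespace false

namespace Summit.MatrixMultiplication.MatrixMultiplication.Theorems

open Polynomial
open scoped Matrix

/-- An injective linear map `f` preserves the dimension of the span of a family: if
`f (g i) = g' i` for all `i` then `dim span {g i} = dim span {g' i}`. -/
theorem hclR_kryT_finrank_span_range_congr {ι M M' : Type*} [AddCommGroup M] [Module ℂ M]
    [AddCommGroup M'] [Module ℂ M'] (f : M →ₗ[ℂ] M') (hf : Function.Injective f) (g : ι → M)
    (g' : ι → M') (h : ∀ i, f (g i) = g' i) :
    Module.finrank ℂ ↥(Submodule.span ℂ (Set.range g)) =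
      Module.finrank ℂ ↥(Submodule.span ℂ (Set.range g')) := by
  have hr : Set.range g' = f '' Set.range g := by
    rw [← Set.range_comp]
    exact congrArg Set.range (funext fun i => (h i).symm)
  rw [hr, Submodule.span_image]
  exact LinearEquiv.finrank_eq (Submodule.equivMapOfInjective f hf _)

/-- **(G4)** Krylov dimensions transfer: the span of the shifted columns
`(Zᵀ)^m *ᵥ (column c' of E)`, `m < w`, has the same dimension as the polynomial Krylov space
`span {divX^[m] (polyE c') : c', m < w}` of the frame `polyE c' := toPoly (column c' of E)`:
by (E5) the second family is the image of the first under the injective linear map `toPoly`. -/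
theorem hclR_finrank_vecKrylov :
    ∀ (r N : ℕ) (E : Matrix (Fin N) (Fin r) ℂ) (w : ℕ), Module.finrank ℂ ↥(Submodule.span ℂ
    (Set.range (fun q : Fin r × Fin w => (((Matrix.transpose (Matrix.of fun i j : Fin (N) =>
    if (i : ℕ) = (j : ℕ) + 1 then (1 : ℂ) else 0)))) ^ (q.2 : ℕ) *ᵥ (fun n => E n q.1)))) =
    Module.finrank ℂ ↥((Submodule.span ℂ (Set.range (fun p : Fin (r) × Fin (w) =>
    Polynomial.divX^[(Prod.snd p).val] (((fun c' => (((Polynomial.degreeLT ℂ (N)).subtype ∘ₗ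
    (Polynomial.degreeLTEquiv ℂ (N)).symm.toLinearMap : (Fin (N) → ℂ) →ₗ[ℂ] Polynomial ℂ))
    (fun n => (E : Matrix (Fin N) (Fin _) ℂ) n c')) : Fin r → Polynomial ℂ) (Prod.fst p)))))) := by
  intro r N E w
  refine hclR_kryT_finrank_span_range_congr _ hclR_toPoly_injective _ _ ?_
  exact fun p => hclR_toPoly_shiftT_pow_mulVec _ _

-- the registered binder `hE` is named inside the `∀`, which the unused-variables linter flags
set_option linter.unusedVariables false in
/-- **(G5)** Independence transfer: if `rank E = r` then the columns of `E` are linearly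
independent, hence so is the polynomial frame `polyE c' := toPoly (column c' of E)`, the image of
the columns under the injective linear map `toPoly`. -/
theorem hclR_polyE_linearIndependent :
    ∀ (r N : ℕ) (E : Matrix (Fin N) (Fin r) ℂ) (hE : E.rank = r), LinearIndependent ℂ ((fun c' =>
    (((Polynomial.degreeLT ℂ (N)).subtype ∘ₗ (Polynomial.degreeLTEquiv ℂ (N)).symm.toLinearMap :
    (Fin (N) → ℂ) →ₗ[ℂ] Polynomial ℂ)) (fun n => (E : Matrix (Fin N) (Fin _) ℂ) n c'))) := by
  intro r N E hE
  -- the columns of `E` are linearly independent: `r = card (Fin r) = dim (span of the columns)`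
  have hcols : LinearIndependent ℂ E.col := by
    rw [linearIndependent_iff_card_eq_finrank_span, Fintype.card_fin, Set.finrank,
      ← Matrix.rank_eq_finrank_span_cols, hE]
  exact hcols.map' _ (LinearMap.ker_eq_bot.mpr hclR_toPoly_injective)

end Summit.MatrixMultiplication.MatrixMultiplication.Theorems
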